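import Summits.Ventures.PercRepro.Defs

/-!
# Grouping two-copy pairs by join and meet (the log-modular regrouping)

Products of two probabilities under the same product law are double sums over pairs of
configurations `(ω, ω')`.  Grouping the pairs by `(ω ⊔ ω', ω ⊓ ω') = (u, v)` — the *class* of
`(u, v)`, `pairClass u v` — and using log-modularity `w(ω) w(ω') = w(u) w(v)`
(`weight_inf_mul_weight_sup`) turns every such double sum into a sum over classes with the
weight `w(u) w(v)` pulled out:

* `sum_sum_weight_mul_eq_sum_pairClass`: `Σ_{ω,ω'} w(ω) w(ω') F(ω,ω') = Σ_{u,v} w(u) w(v) · Σ_{(ω,ω') ∈ class(u,v)} F(ω,ω')`;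
* `prob_mul_prob_eq_sum_pairClass`: `P(A) P(B) = Σ_{u,v} w(u) w(v) · #{(ω,ω') ∈ class(u,v) | ω ∈ A, ω' ∈ B}`.

This is the identity (1) of the canonical chain for C-005 (`conjectures/C-005.md`; p3's §1 /
p4's Theorem A / lead 02:29Z): `top·bot − e₂ = Σ_{v ≤ u} w(u) w(v) · Z[v,u]` with
`Z[v,u] = #{(⊤,⊥) pairs} − #{crossing pairs}` counted inside the class — the weights disappear and
a purely combinatorial statement about each class (Lemma B) remains.  The class of `(u, v)` is
empty unless `v ≤ u` (`pairClass_eq_empty_of_not_le`); it is closed under swapping the pair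
(`swap_mem_pairClass`), and its members lie between `v` and `u` (`mem_pairClass`).
-/

namespace PercRepro

open Finset

variable {E : Type*} [Fintype E] [DecidableEq E]

/-- The class of the pair `(u, v)`: the pairs of configurations with join `u` and meet `v`. -/
def pairClass (u v : Config E) : Finset (Config E × Config E) :=
  univ.filter fun x => x.1 ⊔ x.2 = u ∧ x.1 ⊓ x.2 = v

/-- Membership in a class. -/
theorem mem_pairClass {u v : Config E} {x : Config E × Config E} :
    x ∈ pairClass u v ↔ x.1 ⊔ x.2 = u ∧ x.1 ⊓ x.2 = v := by
  simp [pairClass]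

/-- A class is closed under swapping the two configurations. -/
theorem swap_mem_pairClass {u v : Config E} {x : Config E × Config E} (h : x ∈ pairClass u v) :
    x.swap ∈ pairClass u v := by
  rw [mem_pairClass] at h ⊢
  exact ⟨by rw [show x.swap.1 ⊔ x.swap.2 = x.2 ⊔ x.1 from rfl, sup_comm]; exact h.1,
    by rw [show x.swap.1 ⊓ x.swap.2 = x.2 ⊓ x.1 from rfl, inf_comm]; exact h.2⟩

/-- Both members of a pair of the class `(u, v)` lie between `v` and `u`. -/
theorem le_of_mem_pairClass {u v : Config E} {x : Config E × Config E} (h : x ∈ pairClass u v) :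
    v ≤ x.1 ∧ x.1 ≤ u ∧ v ≤ x.2 ∧ x.2 ≤ u := by
  rw [mem_pairClass] at h
  exact ⟨h.2 ▸ inf_le_left, h.1 ▸ le_sup_left, h.2 ▸ inf_le_right, h.1 ▸ le_sup_right⟩

/-- The class of `(u, v)` is empty unless `v ≤ u`. -/
theorem pairClass_eq_empty_of_not_le {u v : Config E} (h : ¬ v ≤ u) : pairClass u v = ∅ := by
  rw [Finset.eq_empty_iff_forall_notMem]
  intro x hx
  exact h ((le_of_mem_pairClass hx).1.trans (le_of_mem_pairClass hx).2.1)

/-- Log-modularity on a class: every pair of the class `(u, v)` has the weight `w(u) w(v)`. -/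
theorem weight_mul_weight_of_mem_pairClass (p : E → ℝ) {u v : Config E}
    {x : Config E × Config E} (h : x ∈ pairClass u v) :
    weight p x.1 * weight p x.2 = weight p u * weight p v := by
  rw [mem_pairClass] at h
  rw [weight_inf_mul_weight_sup, h.1, h.2, mul_comm]

/-- **The log-modular regrouping**: a double sum over two independent copies, grouped by the
join and the meet of the pair. -/
theorem sum_sum_weight_mul_eq_sum_pairClass (p : E → ℝ) (F : Config E → Config E → ℝ) :
    ∑ ω, ∑ ω', weight p ω * weight p ω' * F ω ω' =
      ∑ u, ∑ v, weight p u * weight p v * ∑ x ∈ pairClass u v, F x.1 x.2 := by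
  rw [← Fintype.sum_prod_type' (fun ω ω' => weight p ω * weight p ω' * F ω ω'),
    ← Fintype.sum_prod_type' (fun u v => weight p u * weight p v * ∑ x ∈ pairClass u v, F x.1 x.2),
    ← Finset.sum_fiberwise (univ : Finset (Config E × Config E))
      (fun x => (x.1 ⊔ x.2, x.1 ⊓ x.2)) (fun x => weight p x.1 * weight p x.2 * F x.1 x.2)]
  refine Finset.sum_congr rfl fun y _ => ?_
  have hcls : (univ.filter fun x : Config E × Config E => (x.1 ⊔ x.2, x.1 ⊓ x.2) = y) =
      pairClass y.1 y.2 := by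
    ext x
    simp [pairClass, Prod.ext_iff]
  rw [hcls, Finset.mul_sum]
  refine Finset.sum_congr rfl fun x hx => ?_
  rw [weight_mul_weight_of_mem_pairClass p hx]

/-! ### A class is the set of complementary splittings of `u ∖ v` -/

/-- Open the edges of `S` on top of the configuration `v`. -/
def fill (v : Config E) (S : Finset E) : Config E := fun e => v e || decide (e ∈ S)

omit [Fintype E] in
/-- Value of `fill` at an edge. -/
@[simp] theorem fill_apply (v : Config E) (S : Finset E) (e : E) :
    fill v S e = (v e || decide (e ∈ S)) := rfl

/-- For `v ≤ u`, the pairs of the class `(u, v)` are exactly the complementary splittings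
`(v ∪ S, v ∪ (u ∖ v ∖ S))`, `S ⊆ u ∖ v`: a sum over the class is a sum over the power set of the
edge set `u ∖ v` (so the class has `2^{|u ∖ v|}` members and is the cube of the interval `[v, u]`). -/
theorem sum_pairClass_eq_sum_powerset {u v : Config E} (huv : v ≤ u) (F : Config E → Config E → ℝ) :
    ∑ x ∈ pairClass u v, F x.1 x.2 =
      ∑ S ∈ (openEdges u \ openEdges v).powerset,
        F (fill v S) (fill v ((openEdges u \ openEdges v) \ S)) := by
  set D := openEdges u \ openEdges v with hD
  have hmemD : ∀ e, e ∈ D ↔ u e = true ∧ ¬ v e = true := fun e => by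
    simp [hD, mem_openEdges]
  have hleft : ∀ x ∈ pairClass u v,
      (fill v (openEdges x.1 \ openEdges v), fill v (D \ (openEdges x.1 \ openEdges v))) = x := by
    intro x hx
    obtain ⟨h1, h2⟩ := mem_pairClass.1 hx
    refine Prod.ext (funext fun e => ?_) (funext fun e => ?_)
    · have hu : u e = (x.1 e || x.2 e) := by rw [← h1]; rfl
      have hv : v e = (x.1 e && x.2 e) := by rw [← h2]; rfl
      simp only [fill_apply, Finset.mem_sdiff, mem_openEdges, hv]
      cases x.1 e <;> cases x.2 e <;> simp
    · have hu : u e = (x.1 e || x.2 e) := by rw [← h1]; rfl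
      have hv : v e = (x.1 e && x.2 e) := by rw [← h2]; rfl
      simp only [fill_apply, Finset.mem_sdiff, hmemD, mem_openEdges, hu, hv]
      cases x.1 e <;> cases x.2 e <;> simp
  refine Finset.sum_nbij' (fun x => openEdges x.1 \ openEdges v)
    (fun S => (fill v S, fill v (D \ S))) ?_ ?_ hleft ?_ ?_
  · intro x hx
    rw [Finset.mem_powerset]
    have hle := (le_of_mem_pairClass hx).2.1
    intro e he
    simp only [Finset.mem_sdiff, mem_openEdges] at he
    exact (hmemD e).2 ⟨Config.le_iff.1 hle e he.1, he.2⟩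
  · intro S hS
    rw [Finset.mem_powerset] at hS
    rw [mem_pairClass]
    constructor
    · funext e
      simp only [Pi.sup_apply, fill_apply]
      by_cases hv : v e = true
      · simp [hv, Config.le_iff.1 huv e hv]
      · by_cases hu : u e = true
        · have heD : e ∈ D := (hmemD e).2 ⟨hu, hv⟩
          by_cases hS' : e ∈ S
          · simp [hv, hu, hS']
          · simp [hv, hu, hS', heD]
        · have hS' : e ∉ S := fun h => hu ((hmemD e).1 (hS h)).1
          have hD' : e ∉ D \ S := fun h => hu ((hmemD e).1 (Finset.mem_sdiff.1 h).1).1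
          simp [hv, hu, hS', hD']
    · funext e
      simp only [Pi.inf_apply, fill_apply]
      by_cases hv : v e = true
      · simp [hv]
      · by_cases hS' : e ∈ S
        · have : e ∉ D \ S := fun h => (Finset.mem_sdiff.1 h).2 hS'
          simp [hv, hS', this]
        · simp [hv, hS']
  · intro S hS
    rw [Finset.mem_powerset] at hS
    ext e
    simp only [Finset.mem_sdiff, mem_openEdges, fill_apply]
    constructor
    · rintro ⟨h1, h2⟩
      simp only [h2, Bool.false_or, decide_eq_true_eq] at h1
      exact h1
    · intro h
      have hv := ((hmemD e).1 (hS h)).2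
      simp [h, hv]
  · intro x hx
    have := congrArg (fun y : Config E × Config E => F y.1 y.2) (hleft x hx)
    exact this.symm

/-- The size of a class: `2^{|u ∖ v|}` when `v ≤ u`. -/
theorem card_pairClass {u v : Config E} (huv : v ≤ u) :
    (pairClass u v).card = 2 ^ (openEdges u \ openEdges v).card := by
  have h := sum_pairClass_eq_sum_powerset huv (fun _ _ => (1 : ℝ))
  simp only [Finset.sum_const, nsmul_eq_mul, mul_one, Finset.card_powerset] at h
  exact_mod_cast h

/-! ### A class is the cube of the interval `[v, u]`: antipodal pairs -/

/-- The cube of the interval `[v, u]` embedded in `Config E`: `embedInterval v D σ` opens, on top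
of `v`, the edges of `D` selected by `σ : Config D`. -/
def embedInterval (v : Config E) (D : Finset E) (σ : Config ↥D) : Config E :=
  fun e => v e || (if h : e ∈ D then σ ⟨e, h⟩ else false)

omit [Fintype E] in
/-- The embedding of the interval cube is monotone in `σ`, so `c ∘ embedInterval v D` is a monotone
map on the cube `Config D` whenever `c` is monotone on `Config E`. -/
theorem monotone_embedInterval (v : Config E) (D : Finset E) : Monotone (embedInterval v D) := by
  intro σ σ' h
  rw [Config.le_iff]
  intro e he
  simp only [embedInterval, Bool.or_eq_true] at he ⊢
  rcases he with he | he
  · exact Or.inl he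
  · right
    split_ifs at he ⊢ with hD
    exact Config.le_iff.1 h _ he

omit [Fintype E] in
/-- The embedded configurations lie above `v`. -/
theorem le_embedInterval (v : Config E) (D : Finset E) (σ : Config ↥D) : v ≤ embedInterval v D σ := by
  rw [Config.le_iff]
  intro e he
  simp [embedInterval, he]

omit [Fintype E] in
/-- `fill v S` is the embedding of the indicator of `S ⊆ D`. -/
theorem fill_eq_embedInterval (v : Config E) {D S : Finset E} (hS : S ⊆ D) :
    fill v S = embedInterval v D (fun d => decide ((d : E) ∈ S)) := by
  funext e
  simp only [fill_apply, embedInterval]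
  by_cases hD : e ∈ D
  · simp [hD]
  · have : e ∉ S := fun h => hD (hS h)
    simp [hD, this]

omit [Fintype E] in
/-- `fill v (D ∖ S)` is the embedding of the complementary indicator. -/
theorem fill_sdiff_eq_embedInterval (v : Config E) {D S : Finset E} (hS : S ⊆ D) :
    fill v (D \ S) = embedInterval v D (fun d => !decide ((d : E) ∈ S)) := by
  funext e
  simp only [fill_apply, embedInterval, Finset.mem_sdiff]
  by_cases hD : e ∈ D
  · simp [hD]
  · have : e ∉ S := fun h => hD (hS h)
    simp [hD, this]

/-- The antipodal pairs `(σ, ¬σ)` of the cube `Config D`, `D = u ∖ v`, are the class of `(u, v)`: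
a sum over the class is a sum over the cube. -/
theorem sum_pairClass_eq_sum_cube {u v : Config E} (huv : v ≤ u) (F : Config E → Config E → ℝ) :
    ∑ x ∈ pairClass u v, F x.1 x.2 =
      ∑ σ : Config ↥(openEdges u \ openEdges v),
        F (embedInterval v (openEdges u \ openEdges v) σ)
          (embedInterval v (openEdges u \ openEdges v) (fun d => !σ d)) := by
  rw [sum_pairClass_eq_sum_powerset huv]
  set D := openEdges u \ openEdges v with hD
  refine Finset.sum_nbij' (fun S => fun d : D => decide ((d : E) ∈ S))
    (fun σ => (Finset.univ.filter fun d : D => σ d = true).map (Function.Embedding.subtype _))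
    (fun _ _ => Finset.mem_univ _) ?_ ?_ ?_ ?_
  · intro σ _
    rw [Finset.mem_powerset]
    intro e he
    simp only [Finset.mem_map, Finset.mem_filter, Finset.mem_univ, true_and,
      Function.Embedding.coe_subtype] at he
    obtain ⟨d, _, rfl⟩ := he
    exact d.2
  · intro S hS
    rw [Finset.mem_powerset] at hS
    ext e
    simp only [Finset.mem_map, Finset.mem_filter, Finset.mem_univ, true_and,
      Function.Embedding.coe_subtype, decide_eq_true_eq]
    constructor
    · rintro ⟨d, hd, rfl⟩
      exact hd
    · intro he
      exact ⟨⟨e, hS he⟩, he, rfl⟩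
  · intro σ _
    funext d
    simp only [Finset.mem_map, Finset.mem_filter, Finset.mem_univ, true_and,
      Function.Embedding.coe_subtype]
    by_cases h : σ d = true
    · simp only [h, decide_eq_true_eq]
      exact ⟨d, h, rfl⟩
    · simp only [h, decide_eq_false_iff_not, not_exists, not_and]
      rintro d' hd' hdd'
      rw [Subtype.ext hdd'] at hd'
      exact h hd'
  · intro S hS
    rw [Finset.mem_powerset] at hS
    rw [fill_eq_embedInterval v hS, fill_sdiff_eq_embedInterval v hS]

open Classical in
/-- The number of pairs of the class `(u, v)` whose first member lies in `A` and whose second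
member lies in `B`. -/
noncomputable def classCount (u v : Config E) (A B : Set (Config E)) : ℕ :=
  (pairClass u v).filter (fun x => x.1 ∈ A ∧ x.2 ∈ B) |>.card

open Classical in
/-- **Products of probabilities as class counts**:
`P(A) P(B) = Σ_{u,v} w(u) w(v) · #{(ω, ω') ∈ class(u, v) | ω ∈ A, ω' ∈ B}`. -/
theorem prob_mul_prob_eq_sum_pairClass (p : E → ℝ) (A B : Set (Config E)) :
    prob p A * prob p B = ∑ u, ∑ v, weight p u * weight p v * (classCount u v A B : ℝ) := by
  have h : prob p A * prob p B =
      ∑ ω, ∑ ω', weight p ω * weight p ω' * (if ω ∈ A ∧ ω' ∈ B then 1 else 0) := by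
    unfold prob
    rw [Finset.sum_mul_sum]
    refine Finset.sum_congr rfl fun ω _ => Finset.sum_congr rfl fun ω' _ => ?_
    by_cases hA : ω ∈ A <;> by_cases hB : ω' ∈ B <;> simp [Set.indicator, hA, hB]
  rw [h, sum_sum_weight_mul_eq_sum_pairClass]
  refine Finset.sum_congr rfl fun u _ => Finset.sum_congr rfl fun v _ => ?_
  congr 1
  rw [classCount, Finset.card_filter]
  push_cast
  rfl

/-! ### Class-count certificates for quadratic forms of the law -/

/-- A non-chain `(u, v)` (not `v ≤ u`) carries no pair at all. -/
theorem classCount_eq_zero_of_not_le {u v : Config E} (h : ¬ v ≤ u) (A B : Set (Config E)) :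
    classCount u v A B = 0 := by
  simp [classCount, pairClass_eq_empty_of_not_le h]

/-- **Quadratic forms of the law as class sums**: a real combination of products of two
probabilities, `Σ_i c_i · P(A_i) P(B_i)`, equals `Σ_{u,v} w(u) w(v) · Z(u, v)` with the class
statistic `Z(u, v) = Σ_i c_i · #{pairs of the class in A_i × B_i}` (it vanishes unless `v ≤ u`). -/
theorem sum_mul_prob2_eq_sum_pairClass {ι : Type*} (s : Finset ι) (c : ι → ℝ)
    (A B : ι → Set (Config E)) (p : E → ℝ) :
    ∑ i ∈ s, c i * (prob p (A i) * prob p (B i)) =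
      ∑ u, ∑ v, weight p u * weight p v * ∑ i ∈ s, c i * (classCount u v (A i) (B i) : ℝ) := by
  simp_rw [prob_mul_prob_eq_sum_pairClass, Finset.mul_sum]
  rw [Finset.sum_comm]
  refine Finset.sum_congr rfl fun u _ => ?_
  rw [Finset.sum_comm]
  refine Finset.sum_congr rfl fun v _ => Finset.sum_congr rfl fun i _ => ?_
  ring

/-- **Class-count certificate ⇒ quadratic inequality** (the Lemma B ⇒ C-005 shape): if the class
statistic `Σ_i c_i · #{class pairs in A_i × B_i}` is nonnegative on every chain `v ≤ u`, then
`Σ_i c_i · P(A_i) P(B_i) ≥ 0` for every weight vector `p ∈ [0, 1]^E`. -/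
theorem sum_mul_prob2_nonneg_of_classCount {ι : Type*} (s : Finset ι) (c : ι → ℝ)
    (A B : ι → Set (Config E)) {p : E → ℝ} (hp : IsProb p)
    (h : ∀ u v : Config E, v ≤ u → 0 ≤ ∑ i ∈ s, c i * (classCount u v (A i) (B i) : ℝ)) :
    0 ≤ ∑ i ∈ s, c i * (prob p (A i) * prob p (B i)) := by
  rw [sum_mul_prob2_eq_sum_pairClass]
  refine Finset.sum_nonneg fun u _ => Finset.sum_nonneg fun v _ => ?_
  by_cases hc : v ≤ u
  · exact mul_nonneg (mul_nonneg (weight_nonneg hp u) (weight_nonneg hp v)) (h u v hc)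
  · simp [classCount_eq_zero_of_not_le hc]

end PercRepro
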